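import Mathlib
import HarnessLib
import Summits.Langlands.Langlands.Theorems.EisensteinGelfandKirillovProModularOfGKBoundTwoLeafFernDefs
import Literature.NumberTheory.Automorphic.HeckePointValuesFiniteExtension
import Summits.Langlands.Langlands.Theorems.ReducibleOrdinaryProModular.Negative.LevelAndRamification
import Summits.Langlands.Langlands.Theorems.EisensteinProModularSeed.Negative.BorelAndEisenstein

/-!
# Stub `stub_closure` (line `two-leaf-fern`, crux `ProModularOfGKBound`, stmt-Langlands-18273):
# pro-modularity is Zariski closed

Let `R` be a compact Hausdorff local topological ring with `p ∈ 𝔪_R` (`p ≥ 5`), `T : Γ_F → R`,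
`𝒰` a tame level of `GL₂/F`, `x : R → ℚ̄_p` a continuous point with `J_𝒰 ≤ ker x`, where
`J_𝒰 = proModularIdeal R T 𝒰 = ⨅ ker z` over the continuous points `z` whose trace function `z ∘ T`
is the trace of a `𝒰`-pro-modular `ρ_z`.  If `ρ' : Γ_F → GL₂(ℚ̄_p)` has trace function `x ∘ T` and
is unramified outside `𝒰.bad`, then `ρ'` is `𝒰`-pro-modular (`TameLevel.IsPadicallyAutomorphic`).

Proof (Mathlib topology/algebra and the tree's generator identities of `𝕋(𝒰)` only).  Let `Z` be
the set of pro-modular data `z` (with choices `ρ_z` and a continuous `y_z : 𝕋(𝒰) → ℚ̄_p` associated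
with `ρ_z`), `Ψ = (z)_z : R → ∏_Z ℚ̄_p` and `Y = (y_z)_z : 𝕋(𝒰) → ∏_Z ℚ̄_p` (continuous ring maps).

* `ker Ψ = J_𝒰 ≤ ker x`; `Ψ(R)` is compact, hence closed;
* for `v ∉ 𝒰.bad` and ANY arithmetic Frobenius `σ` above `v`, association of `y_z` with `ρ_z`
  (`trace_det_frob_of_isAssociated`) and `tr² − tr ∘ sq = 2 det` in rank two give
  `y_z(T_{v,1}) = z(T σ)`, `y_z(T_{v,2}) = z(u₂ u_q D(σ))`,
  `y_z([U t_{v,2}⁻¹ U]) = z(q_v u₂ D(σ⁻¹))` with `D(g) = T(g)² − T(g²)`, `2 u₂ = 1`, `q_v u_q = 1`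
  in `R` (`2`, `q_v` are prime to `p`:
  `isUnit_natCast_of_coprime`, `Ideal.exists_prime_and_absNorm_eq_pow`) and
  `det ρ_z(σ)⁻¹ = det ρ_z(σ⁻¹)`; with `T_{v,0} = 1`, `T_{v,i} = T_{v,2}` (`i ≥ 2`) every topological
  generator of `𝕋(𝒰)` is mapped by `Y` into `Ψ(R)`, hence so is all of `𝕋(𝒰)` (the closed subring
  `Y⁻¹(Ψ(R))` contains the generators; pattern of the sibling stub `stub_readout`);
* `R ↠ Ψ(R)` is a quotient map (compact → Hausdorff), so `x` factors through a CONTINUOUS ring map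
  `x̄ : Ψ(R) → ℚ̄_p` (`RingHom.liftOfRightInverse`, `ker Ψ ≤ ker x`), and `w = x̄ ∘ Y` is a
  continuous point of `𝕋(𝒰)` with `w(T_{v,1}) = x(T σ) = tr ρ'(σ)`,
  `q_v w(T_{v,2}) = x(D σ)/2 = det ρ'(σ)` for every arithmetic Frobenius `σ` above `v ∉ 𝒰.bad`;
  `charpoly = X² − tr X + det`
  (`Matrix.charpoly_fin_two`, `heckeFrobPoly_two`) is the association, and unramifiedness of `ρ'`
  off `𝒰.bad` is a hypothesis.
-/

set_option linter.dupNamespace false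
set_option autoImplicit false

noncomputable section

open scoped NumberField Matrix Polynomial
open Filter Field IsDedekindDomain Topology
open Literature.NumberTheory.GaloisRepresentations Literature.NumberTheory.Automorphic
open Literature.NumberTheory.Automorphic.BigHeckeGLn
open Summit.Langlands.Langlands.Theorems.ReducibleOrdinaryProModular.Negative
  (isPadicallyAutomorphic_iff heckeFrobPoly_two)
open Summit.Langlands.Langlands.Theorems.EisensteinProModularSeed.Negative
  (trace_det_frob_of_isAssociated)

namespace Summit.Langlands.Langlands.Cruxes.ProModularOfGKBound.TwoLeafFern

/-! ## Elementary lemmas -/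

/-- `tr(M)·tr(M) − tr(M·M) = 2 det M` for a `2 × 2` matrix over a commutative ring (Newton's
identity in rank two). [folklore] -/
private theorem trace_mul_trace_sub_trace_mul {A : Type*} [CommRing A]
    (M : Matrix (Fin 2) (Fin 2) A) : M.trace * M.trace - (M * M).trace = 2 * M.det := by
  simp only [Matrix.trace_fin_two, Matrix.det_fin_two, Matrix.mul_apply, Fin.sum_univ_two]
  ring

/-- `det ρ(g) · det ρ(g⁻¹) = 1` for a framed representation. [folklore] -/
private theorem det_mul_det_inv {G A : Type*} [Group G] [TopologicalSpace G] [CommRing A]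
    [TopologicalSpace A] {n : ℕ} (ρ : FramedRep G A n) (g : G) :
    ((ρ g : GL (Fin n) A) : Matrix (Fin n) (Fin n) A).det *
      ((ρ g⁻¹ : GL (Fin n) A) : Matrix (Fin n) (Fin n) A).det = 1 := by
  rw [← Matrix.det_mul, ← Units.val_mul, ← map_mul, mul_inv_cancel, map_one, Units.val_one,
    Matrix.det_one]

/-- The norm `q_v = N(v)` of a finite place `v` not above `p` is prime to `p`: `N(v)` is a power of
the rational prime lying in `v` (Mathlib `Ideal.exists_prime_and_absNorm_eq_pow`). [folklore] -/
private theorem coprime_absNorm {F : Type} [Field F] [NumberField F] {p : ℕ} (hp : p.Prime)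
    (v : HeightOneSpectrum (𝓞 F)) (hv : ((p : ℕ) : 𝓞 F) ∉ v.asIdeal) :
    (Ideal.absNorm v.asIdeal).Coprime p := by
  obtain ⟨ℓ, k, -, hℓv, hℓ, hN⟩ := Ideal.exists_prime_and_absNorm_eq_pow v.asIdeal
  rw [hN]
  refine Nat.Coprime.pow_left k ((Nat.coprime_primes hℓ hp).2 fun h => hv ?_)
  rw [← h]
  exact hℓv

/-! ## A closed subring of `𝕋(𝒰)` containing the topological generators is everything -/

/-- If a closed subring `M ⊆ 𝕋(𝒰)` contains every `T_{v,i}` and every `[U t_{v,n}⁻¹ U]`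
(`v ∉ 𝒰.bad`), then `M = 𝕋(𝒰)`: its image in the ambient product of discrete rings is closed
(`𝕋(𝒰)` is closed there) and contains `𝒰.heckeGenerators`, hence the closure of the subring they
generate, which is `𝕋(𝒰)` by definition (same argument as the sibling stub `stub_readout`,
`EisensteinGelfandKirillovProModularOfGKBoundStubReadout`). [folklore] -/
private theorem eq_top_of_isClosed_of_generators_mem {n : ℕ} {F : Type} [Field F] [NumberField F]
    {p : ℕ} [Fact p.Prime] (𝒰 : TameLevel n F p)
    (M : Subring (CompletedCohomologyHeckeAlgebraGLn 𝒰))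
    (hM : IsClosed (M : Set (CompletedCohomologyHeckeAlgebraGLn 𝒰)))
    (hT : ∀ v : HeightOneSpectrum (𝓞 F), v ∉ 𝒰.bad → ∀ i : ℕ, 𝒰.heckeT v i ∈ M)
    (hS : ∀ (v : HeightOneSpectrum (𝓞 F)) (hv : v ∉ 𝒰.bad),
      (⟨𝒰.heckeOperator (heckeElement n F v n)⁻¹, 𝒰.heckeOperator_inv_mem hv⟩ :
        CompletedCohomologyHeckeAlgebraGLn 𝒰) ∈ M) :
    M = ⊤ := by
  refine eq_top_iff.2 fun t _ => ?_
  -- the generators lie in the image `M'` of `M` in the ambient product ring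
  have hgen : 𝒰.heckeGenerators ⊆ (M.map 𝒰.bigHeckeSubring.subtype : Set 𝒰.bigEnd) := by
    rintro g (⟨v, hv, i, rfl⟩ | ⟨v, hv, rfl⟩)
    · exact Subring.mem_map.2 ⟨𝒰.heckeT v i, hT v hv i, 𝒰.coe_heckeT hv i⟩
    · exact Subring.mem_map.2 ⟨_, hS v hv, rfl⟩
  -- `M'` is closed: `M` is closed in the closed subspace `𝕋(𝒰)` of the product
  have hM' : IsClosed (M.map 𝒰.bigHeckeSubring.subtype : Set 𝒰.bigEnd) := by
    rw [Subring.coe_map]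
    exact (Subring.isClosed_topologicalClosure _).isClosedEmbedding_subtypeVal.isClosedMap _ hM
  -- hence `𝕋(𝒰) = closure ⟨generators⟩ ≤ M'`
  have hle : 𝒰.bigHeckeSubring ≤ M.map 𝒰.bigHeckeSubring.subtype :=
    Subring.topologicalClosure_minimal _ (Subring.closure_le.2 hgen) hM'
  obtain ⟨m, hm, hmt⟩ := Subring.mem_map.1 (hle t.2)
  rw [← Subtype.ext hmt]
  exact hm

/-! ## Continuous factorisation through the image of a compact ring -/

/-- Let `Ψ : R → P` be a continuous ring map out of a COMPACT ring into a Hausdorff ring,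
`x : R → C` a continuous ring map killing `ker Ψ`, and `Y : T → P` a continuous ring map with
values in `Ψ(R)`.
Then there is a continuous ring map `w : T → C` with `w(t) = x(r)` whenever `Ψ(r) = Y(t)`:
`x` factors through `x̄ : Ψ(R) → C` (`RingHom.liftOfRightInverse`), continuous because
`R ↠ Ψ(R)` is a quotient map (continuous surjection, compact onto Hausdorff), and `w = x̄ ∘ Y`.
[folklore] -/
private theorem exists_ringHom_factor {R P C T : Type*} [Ring R] [Ring P] [Ring C] [Ring T]
    [TopologicalSpace R] [CompactSpace R] [TopologicalSpace P] [T2Space P] [TopologicalSpace C]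
    [TopologicalSpace T] (Ψ : R →+* P) (x : R →+* C) (Y : T →+* P) (hΨ : Continuous Ψ)
    (hx : Continuous x) (hY : Continuous Y) (hker : RingHom.ker Ψ ≤ RingHom.ker x)
    (hrange : ∀ t, Y t ∈ Set.range Ψ) :
    ∃ w : T →+* C, Continuous w ∧ ∀ t r, Ψ r = Y t → w t = x r := by
  set Ψ' : R →+* Ψ.range := Ψ.rangeRestrict
  have hsurj : Function.Surjective Ψ' := Ψ.rangeRestrict_surjective
  have hΨ'c : Continuous Ψ' := continuous_induced_rng.2 hΨ
  have hker' : RingHom.ker Ψ' ≤ RingHom.ker x := by rwa [RingHom.ker_rangeRestrict]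
  set xbar : Ψ.range →+* C :=
    Ψ'.liftOfRightInverse (Function.surjInv hsurj) (Function.rightInverse_surjInv hsurj) ⟨x, hker'⟩
  have hxbar : ∀ r, xbar (Ψ' r) = x r := fun r =>
    Ψ'.liftOfRightInverse_comp_apply (Function.surjInv hsurj) (Function.rightInverse_surjInv hsurj)
      ⟨x, hker'⟩ r
  have hxbarc : Continuous xbar := by
    rw [(IsQuotientMap.of_surjective_continuous hsurj hΨ'c).continuous_iff]
    have e : (xbar ∘ Ψ' : R → C) = x := funext hxbar
    rw [e]
    exact hx
  set Y' : T →+* Ψ.range := Y.codRestrict Ψ.range fun t => RingHom.mem_range.2 (hrange t)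
  have hY'c : Continuous Y' := continuous_induced_rng.2 hY
  refine ⟨xbar.comp Y', hxbarc.comp hY'c, fun t r h => ?_⟩
  have e : Y' t = Ψ' r := Subtype.ext h.symm
  rw [RingHom.comp_apply, e, hxbar]

/-! ## The stub -/

/-- **Stub C — `stub_closure` (PRO-MODULARITY IS ZARISKI-CLOSED; raw form).**  Let `R` be a
compact Hausdorff local topological ring with `p ∈ 𝔪_R` (`p ≥ 5`), `T : Γ_F → R` continuous, `𝒰` a
tame level of `GL₂/F`, and `x : R → ℚ̄_p` a continuous point killing the pro-modular ideal
`J_𝒰 = proModularIdeal R T 𝒰`.  If `ρ' : Γ_F → GL₂(ℚ̄_p)` has trace function `x ∘ T` and is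
unramified outside `𝒰.bad`, then `ρ'` is `𝒰`-pro-modular.  Proof: with `Z` the set of pro-modular
data `(z, ρ_z, y_z)`, `Ψ = (z)_z : R → ∏_Z ℚ̄_p` (`ker Ψ = J_𝒰 ≤ ker x`, image compact hence closed,
`x` factors continuously through it) and `Y = (y_z)_z : 𝕋(𝒰) → ∏_Z ℚ̄_p`, one has
`Y(T_{v,1}) = Ψ(T σ)`, `Y(T_{v,2}) = Ψ(u₂ u_q D σ)`, `Y([U t_{v,2}⁻¹ U]) = Ψ(q_v u₂ D σ⁻¹)`
(`D = T² − T∘sq`, `2 u₂ = 1`, `q_v u_q = 1`) at any arithmetic Frobenius `σ` above `v ∉ 𝒰.bad`, and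
`T_{v,0} = 1`, `T_{v,i} = T_{v,2}` (`i ≥ 2`); hence
`Y(𝕋(𝒰)) ⊆ Ψ(R)` and `w := x̄ ∘ Y` is the wanted continuous point, associated with `ρ'` by
`charpoly = X² − tr X + det`.  No commutativity of `𝕋(𝒰)` is needed.
[cite: Chenevier2011, §1 (R ↠ 𝕋, 𝔛^{mod} closed)] [cite: GeeNewton2020, §2.1.3 and Lemma 2.1.8]
[cite: CalegariEmerton2011, §2] -/
theorem stub_closure :
    ∀ (F : Type) [Field F] [NumberField F] (p : ℕ) [Fact p.Prime], 5 ≤ p →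
    ∀ (R : Type) [CommRing R] [TopologicalSpace R] [IsTopologicalRing R] [CompactSpace R]
      [T2Space R] [IsLocalRing R],
      ((p : ℕ) : R) ∈ IsLocalRing.maximalIdeal R →
    ∀ (T : absoluteGaloisGroup F → R), Continuous T →
    ∀ (𝒰 : TameLevel 2 F p) (x : R →+* PadicAlgCl p), Continuous x →
    ∀ (ρ' : FramedGaloisRep F (PadicAlgCl p) 2),
      (∀ g, x (T g) = ((ρ' g : GL (Fin 2) (PadicAlgCl p)) : Matrix (Fin 2) (Fin 2) (PadicAlgCl p)).trace) →
      (∀ v, v ∉ 𝒰.bad → ρ'.IsUnramifiedAt v) →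
      proModularIdeal R T 𝒰 ≤ RingHom.ker x →
      𝒰.IsPadicallyAutomorphic ρ' := by
  intro F _ _ p _ hp R _ _ _ _ _ _ hpm T _ 𝒰 x hx ρ' hxT hur hJ
  have hpp : p.Prime := Fact.out
  -- the index set `Z` of pro-modular data, with choices `ρ_z`, `y_z` for each `z ∈ Z`
  let Z : Type := {z : R →+* PadicAlgCl p // Continuous z ∧
    ∃ ρz : FramedGaloisRep F (PadicAlgCl p) 2,
      (∀ g, z (T g) = ((ρz g : GL (Fin 2) (PadicAlgCl p)) :
        Matrix (Fin 2) (Fin 2) (PadicAlgCl p)).trace) ∧ 𝒰.IsPadicallyAutomorphic ρz}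
  have hZ : ∀ zZ : Z, ∃ (ρz : FramedGaloisRep F (PadicAlgCl p) 2)
      (y : CompletedCohomologyHeckeAlgebraGLn 𝒰 →+* PadicAlgCl p),
      (∀ g, zZ.1 (T g) = ((ρz g : GL (Fin 2) (PadicAlgCl p)) :
        Matrix (Fin 2) (Fin 2) (PadicAlgCl p)).trace) ∧ Continuous y ∧ 𝒰.IsAssociated y ρz := by
    intro zZ
    obtain ⟨ρz, hzT, y, hyc, hya⟩ := zZ.2.2
    exact ⟨ρz, y, hzT, hyc, hya⟩
  choose ρz y hzT hyc hya using hZ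
  -- `2` and the `q_v` (`v ∉ 𝒰.bad`) are units of `R`
  obtain ⟨u₂, hu₂⟩ : ∃ u : R, 2 * u = 1 := by
    have h2 : IsUnit ((2 : ℕ) : R) :=
      isUnit_natCast_of_coprime hpm ((Nat.coprime_primes Nat.prime_two hpp).2 (by omega))
    rw [Nat.cast_ofNat] at h2
    exact h2.exists_right_inv
  have hq : ∀ v : HeightOneSpectrum (𝓞 F), v ∉ 𝒰.bad →
      ∃ u : R, (Ideal.absNorm v.asIdeal : R) * u = 1 := fun v hv =>
    (isUnit_natCast_of_coprime hpm
      (coprime_absNorm hpp v fun h => hv (𝒰.mem_bad_of_mem v h))).exists_right_inv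
  choose! uq huq using hq
  -- the two continuous ring maps into `∏_Z ℚ̄_p`
  let Ψ : R →+* (Z → PadicAlgCl p) := RingHom.pi fun zZ => zZ.1
  let Y : CompletedCohomologyHeckeAlgebraGLn 𝒰 →+* (Z → PadicAlgCl p) := RingHom.pi fun zZ => y zZ
  have hΨc : Continuous Ψ := continuous_pi fun zZ => zZ.2.1
  have hYc : Continuous Y := continuous_pi fun zZ => hyc zZ
  -- `ker Ψ = J_𝒰 ≤ ker x`
  have hker : RingHom.ker Ψ ≤ RingHom.ker x := by
    intro r hr
    refine hJ ?_
    rw [proModularIdeal, Ideal.mem_iInf]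
    intro z
    rw [Ideal.mem_iInf]
    intro hz
    exact congrFun (RingHom.mem_ker.1 hr) ⟨z, hz⟩
  -- the generator identities at ANY arithmetic Frobenius `σ` above `v ∉ 𝒰.bad`
  have hids : ∀ (zZ : Z) {v : HeightOneSpectrum (𝓞 F)} (hv : v ∉ 𝒰.bad)
      {𝔓 : Ideal (absIntegers (𝓞 F) F)} (_ : 𝔓 ∈ v.primesAbove) {σ : absoluteGaloisGroup F}
      (_ : IsArithFrobAt (𝓞 F) σ 𝔓),
      y zZ (𝒰.heckeT v 1) = zZ.1 (T σ) ∧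
      y zZ (𝒰.heckeT v 2) = zZ.1 (u₂ * uq v * (T σ * T σ - T (σ * σ))) ∧
      y zZ ⟨𝒰.heckeOperator (heckeElement 2 F v 2)⁻¹, 𝒰.heckeOperator_inv_mem hv⟩ =
        zZ.1 ((Ideal.absNorm v.asIdeal : R) * u₂ * (T σ⁻¹ * T σ⁻¹ - T (σ⁻¹ * σ⁻¹))) := by
    intro zZ v hv 𝔓 h𝔓 σ hσ
    have hD : ∀ g, zZ.1 (T g * T g - T (g * g)) = 2 *
        ((ρz zZ g : GL (Fin 2) (PadicAlgCl p)) : Matrix (Fin 2) (Fin 2) (PadicAlgCl p)).det := by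
      intro g
      rw [map_sub, map_mul, hzT, hzT, map_mul (ρz zZ), Units.val_mul]
      exact trace_mul_trace_sub_trace_mul _
    have h2 : 2 * zZ.1 u₂ = 1 := by
      have e := congrArg zZ.1 hu₂
      rwa [map_mul, map_ofNat, map_one] at e
    have hqq : (Ideal.absNorm v.asIdeal : PadicAlgCl p) * zZ.1 (uq v) = 1 := by
      have e := congrArg zZ.1 (huq v hv)
      rwa [map_mul, map_natCast, map_one] at e
    obtain ⟨htr, hdet⟩ := trace_det_frob_of_isAssociated (hya zZ) hv h𝔓 hσ
    refine ⟨?_, ?_, ?_⟩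
    · rw [← htr, hzT]
    · rw [map_mul, map_mul, hD, hdet]
      calc y zZ (𝒰.heckeT v 2)
          = 2 * zZ.1 u₂ * ((Ideal.absNorm v.asIdeal : PadicAlgCl p) * zZ.1 (uq v)) *
              y zZ (𝒰.heckeT v 2) := by rw [h2, hqq, one_mul, one_mul]
        _ = zZ.1 u₂ * zZ.1 (uq v) *
              (2 * ((Ideal.absNorm v.asIdeal : PadicAlgCl p) * y zZ (𝒰.heckeT v 2))) := by ring
    · rw [𝒰.apply_heckeOperator_inv_eq_inv (y zZ) hv]
      refine inv_eq_of_mul_eq_one_left ?_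
      rw [map_mul, map_mul, map_natCast, hD]
      calc (Ideal.absNorm v.asIdeal : PadicAlgCl p) * zZ.1 u₂ *
            (2 * ((ρz zZ σ⁻¹ : GL (Fin 2) (PadicAlgCl p)) :
              Matrix (Fin 2) (Fin 2) (PadicAlgCl p)).det) * y zZ (𝒰.heckeT v 2)
          = 2 * zZ.1 u₂ * (((ρz zZ σ⁻¹ : GL (Fin 2) (PadicAlgCl p)) :
              Matrix (Fin 2) (Fin 2) (PadicAlgCl p)).det *
              ((Ideal.absNorm v.asIdeal : PadicAlgCl p) * y zZ (𝒰.heckeT v 2))) := by ring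
        _ = 1 := by rw [h2, one_mul, ← hdet, mul_comm, det_mul_det_inv]
  -- an arithmetic Frobenius above every place
  have hfrob : ∀ v : HeightOneSpectrum (𝓞 F), ∃ (𝔓 : Ideal (absIntegers (𝓞 F) F))
      (σ : absoluteGaloisGroup F), 𝔓 ∈ v.primesAbove ∧ IsArithFrobAt (𝓞 F) σ 𝔓 := fun v => by
    obtain ⟨𝔓, h𝔓⟩ := HeightOneSpectrum.primesAbove_nonempty v
    obtain ⟨σ, hσ⟩ := HeightOneSpectrum.exists_isArithFrobAt_of_mem_primesAbove_holds h𝔓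
    exact ⟨𝔓, σ, h𝔓, hσ⟩
  choose 𝔓v σv h𝔓v hσv using hfrob
  -- `Y(𝕋(𝒰)) ⊆ Ψ(R)`: the closed subring `Y⁻¹(Ψ(R))` of `𝕋(𝒰)` contains the generators
  have hrange : ∀ t, Y t ∈ Set.range Ψ := by
    have htop : (Ψ.range).comap Y = ⊤ := by
      refine eq_top_of_isClosed_of_generators_mem 𝒰 _ ?_ (fun v hv i => ?_) (fun v hv => ?_)
      · rw [Subring.coe_comap, RingHom.coe_range]
        exact (isCompact_range hΨc).isClosed.preimage hYc
      · rcases i with _ | _ | i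
        · exact ⟨1, by rw [𝒰.heckeT_zero hv, map_one, map_one]⟩
        · exact ⟨T (σv v), funext fun zZ => ((hids zZ hv (h𝔓v v) (hσv v)).1).symm⟩
        · rw [𝒰.heckeT_eq_of_le v (by omega)]
          exact ⟨u₂ * uq v * (T (σv v) * T (σv v) - T (σv v * σv v)),
            funext fun zZ => ((hids zZ hv (h𝔓v v) (hσv v)).2.1).symm⟩
      · exact ⟨(Ideal.absNorm v.asIdeal : R) * u₂ *
            (T (σv v)⁻¹ * T (σv v)⁻¹ - T ((σv v)⁻¹ * (σv v)⁻¹)),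
          funext fun zZ => ((hids zZ hv (h𝔓v v) (hσv v)).2.2).symm⟩
    intro t
    have ht : t ∈ (Ψ.range).comap Y := htop ▸ Subring.mem_top t
    exact ht
  -- the continuous point `w = x̄ ∘ Y` of `𝕋(𝒰)`
  obtain ⟨w, hwc, hw⟩ := exists_ringHom_factor Ψ x Y hΨc hx hYc hker hrange
  rw [isPadicallyAutomorphic_iff]
  refine ⟨w, hwc, fun v hv => ⟨hur v hv, fun 𝔓 h𝔓 σ hσ => ?_⟩⟩
  -- association at an arbitrary arithmetic Frobenius `σ` above `v`
  have hw1 : w (𝒰.heckeT v 1) = x (T σ) :=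
    hw _ _ (funext fun zZ => ((hids zZ hv h𝔓 hσ).1).symm)
  have hw2 : w (𝒰.heckeT v 2) = x (u₂ * uq v * (T σ * T σ - T (σ * σ))) :=
    hw _ _ (funext fun zZ => ((hids zZ hv h𝔓 hσ).2.1).symm)
  have hx2 : 2 * x u₂ = 1 := by
    have e := congrArg x hu₂
    rwa [map_mul, map_ofNat, map_one] at e
  have hxq : (Ideal.absNorm v.asIdeal : PadicAlgCl p) * x (uq v) = 1 := by
    have e := congrArg x (huq v hv)
    rwa [map_mul, map_natCast, map_one] at e
  have hdet : (Ideal.absNorm v.asIdeal : PadicAlgCl p) * x (u₂ * uq v * (T σ * T σ - T (σ * σ))) =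
      ((ρ' σ : GL (Fin 2) (PadicAlgCl p)) : Matrix (Fin 2) (Fin 2) (PadicAlgCl p)).det := by
    rw [map_mul, map_mul, map_sub, map_mul, hxT, hxT, map_mul ρ', Units.val_mul,
      trace_mul_trace_sub_trace_mul]
    calc (Ideal.absNorm v.asIdeal : PadicAlgCl p) * (x u₂ * x (uq v) *
          (2 * ((ρ' σ : GL (Fin 2) (PadicAlgCl p)) : Matrix (Fin 2) (Fin 2) (PadicAlgCl p)).det))
        = 2 * x u₂ * ((Ideal.absNorm v.asIdeal : PadicAlgCl p) * x (uq v)) *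
            ((ρ' σ : GL (Fin 2) (PadicAlgCl p)) : Matrix (Fin 2) (Fin 2) (PadicAlgCl p)).det := by
          ring
      _ = ((ρ' σ : GL (Fin 2) (PadicAlgCl p)) : Matrix (Fin 2) (Fin 2) (PadicAlgCl p)).det := by
          rw [hx2, hxq, one_mul, one_mul]
  simp only [heckeFrobPoly_two]
  rw [hw1, hw2, hxT σ, hdet]
  exact Matrix.charpoly_fin_two _

end Summit.Langlands.Langlands.Cruxes.ProModularOfGKBound.TwoLeafFern

end
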